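/-
Copyright (c) 2026 the pub-hodgecm-mathlib formalisation cell (harness21).  Prover seat hodgecm-mathlib-K2E3-p27 (g0), HCML Track B «K2-LIT» ∕ h413
(`stmt-HodgeConjecture-24833`), line `K2_E3_EllipticInputs`, leaf (nsc-S-A′), D124 (the C1″ downstream trio, K2E3-p03 (g7) plan 14:13:23Z) FILE 2 «S0IRR»:
THE QUOTIENT `S₀ = I(X) ⁄ Φ(D″)` IS IRREDUCIBLE (modulo the cell binder `h3cell` and the letter `hNYA`).  2026-09-04.
-/
import Summits.HodgeConjecture.HodgeConjecture.Theorems.K2E3GL3OneLinkNestedHighAmbient        -- ★ p860922 (K2E3-p03): the `S₀`-table, pieces of `S₀` are admissible with `r_B ≠ 0`; brings ★ C2 toolbox ∕ IRR″-a ∕ H0 ∕ GL2-UNL ∕ ADD ∕ EXH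
import Summits.HodgeConjecture.HodgeConjecture.Theorems.K2E3GL3OneLinkNestedHighConstituentY   -- ★ p860898 (this seat): `exists_constituent_Y_one`
import Literature.NumberTheory.Automorphic.IrreducibleClassesConstituents                        -- ★ `IrrClass.IsConstituentOf.of_subrepresentation ∕ of_quotientRep`
import HarnessLib

/-!
# Crux `H413` — leaf (nsc-S-A′), C1″ tail (D124) FILE 2: `S₀ = I(X) ⁄ Φ(D″)` IS IRREDUCIBLE

Cell `hodgecm-mathlib`, Track B; THEOREMS ONLY; count-neutral helper (`--supports stmt-HodgeConjecture-24833 --as helper`).  Letters as in ★ IRR″-a∕-b (K2E3-p17) and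
★ p860922 `K2E3GL3OneLinkNestedHighAmbient` (K2E3-p03): `a = η·ν^{-1∕2}`, `aν = η·ν^{1∕2}`, `X = tch(a,aν,aν)`, `Y = tch(aν,a,aν)`, `Z = tch(aν,aν,a)`, `D″ = D(η, ην^{1∕2})`
(the `P₂₁`-standard module, ★ STD-EMB bytes), `I(X)` the principal series (★ E4a bytes), and for ANY injective intertwining map `Φ : D″ → I(X)` the quotient
`S₀ := Φ.range.quotientRep` with ★ Ambient §2's table `mult S₀ X = 0`, `mult S₀ Y ≤ 1`, `mult S₀ Z = 2`, `mult S₀ ζ = 0` off `{X, Y, Z}`.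

* §1 **`exists_piece_Y_one`** — for `⊥ ≠ N ≠ ⊤` in `S₀`, one of the two pieces `P ∈ {N, S₀ ⁄ N}` has `mult_P Y = 1` and NO other weight: ★ ADD splits the table, ★ H0's
  parity `even_finrank_weightSpace₀₁` (`Z = tch(aν,aν,a)` has equal first entries; `I₂(aν,aν)` is irreducible, ★ GL2-UNL) makes both `Z`-multiplicities even, so
  one piece is `Z`-free; that piece is not weightless (★ EXH ∕ ★ C2 toolbox, its constituents having `r_B ≠ 0` by ★ Ambient under `h3cell`), hence carries exactly `Y¹`.
  The byte-mirror of ★ IRR″-b `K2E3GL3OneLinkNestedHighSplit.exists_piece_X_two` on the `S₀`-table.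
* §2 **`isIrreducible_quotient (hη) (h3cell) (hNYA) (Φ) (hΦ) : (Φ.range.quotientRep).IsIrreducible`** — `S₀ ≠ 0` (`mult S₀ Z = 2`, ★ `nontrivial_of_finrank_weightSpace_ne_zero`);
  a proper non-zero `N` would give a `{Y¹}`-piece (§1), hence (★ p860898 `exists_constituent_Y_one`) an irreducible constituent `r` of `S₀` with `E(r) = {Y¹}`, admissible
  (★ Ambient `isAdmissible_of_isConstituentOf_quotient`) — excluded by the letter `hNYA` («no admissible irreducible with `E = {Y¹}`», K2E3-p17's NAA, bytes of K2E3-p03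
  14:13:23Z VERBATIM).  Consumer: FILE 3 `K2E3GL3OneLinkNestedHigh` (traces of `D″` and `S₀`, payer `sAprimeC1high_of`).

HONEST LABEL: HC_CM is proved only modulo the 7 printed citations (2 remaining named inputs: hLiu418 = stmt-HodgeConjecture-24832, h413 =
stmt-HodgeConjecture-24833) until rung 0 closes; count-neutral helper, CONDITIONAL on the binders `h3cell` (★ (CELL-3) `K2E3GL3PrincipalSeriesThreeCell` discharges it) and
`hNYA` (open, K2E3-p17 lineage), stated not assumed.

## References
* [BernsteinZelevinsky1977] I. N. Bernstein, A. V. Zelevinsky, *Induced representations of reductive p-adic groups I*, Ann. Sci. ÉNS 10 (1977), §2.3, Cor. 2.13, Thm. 2.9.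
* [Zelevinsky1980] A. V. Zelevinsky, *Induced representations of reductive p-adic groups II*, Ann. Sci. ÉNS 13 (1980), §1.6, Ex. 3.2, Thm. 6.1.
* [Casselman1995] W. Casselman, *Introduction to the theory of admissible representations of p-adic reductive groups* (1995 notes), §6.3, Cor. 7.1.2.
-/

set_option autoImplicit false
-- the mandated namespace repeats `HodgeConjecture.HodgeConjecture`, as in every `Theorems/*.lean` of this sub-problem
set_option linter.dupNamespace false

noncomputable section

open Module Representation Literature.NumberTheory.Automorphic Literature.NumberTheory.Automorphic.Zelevinsky1980 Literature.NumberTheory.GaloisRepresentations.IsNonarchimedeanLocalField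
open Literature.RepresentationTheory.FiniteGroups
open scoped MatrixGroups NNReal
open Summit.HodgeConjecture.HodgeConjecture.Cruxes.H413.K2E3GL3OneLinkNestedHighPieces (isOpen_ker_b)
open Summit.HodgeConjecture.HodgeConjecture.Cruxes.H413.K2E3GL3ExponentRules (even_finrank_weightSpace₀₁)
open Summit.HodgeConjecture.HodgeConjecture.Cruxes.H413.K2E3GL2UnlinkedIrreducible (isIrreducible_parabolicIndGL_two_self)
open Summit.HodgeConjecture.HodgeConjecture.Cruxes.H413.K2E3GL2JacquetModuleStructure (continuous_unitsCoe_of_isOpen_ker)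
open Summit.HodgeConjecture.HodgeConjecture.Cruxes.H413.K2E3GL3JacquetMultiplicityAdditive (finrank_weightSpace_eq_add_subrepresentation finiteDimensional_jacquet_subrepresentation
  finiteDimensional_jacquet_quotientRep)
open Summit.HodgeConjecture.HodgeConjecture.Cruxes.H413.K2E3GL3PrincipalSeriesExhaustion (exists_finrank_weightSpace_quotientRep_ne_zero)
open Summit.HodgeConjecture.HodgeConjecture.Cruxes.H413.K2E3GL3ExponentClassTools (nontrivial_of_finrank_weightSpace_ne_zero bot_ne_top_subrepresentation
  exists_finrank_weightSpace_ne_zero_of_ne_bot)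
open Summit.HodgeConjecture.HodgeConjecture.Cruxes.H413.K2E3GL3OneLinkNestedHighAmbient (isSmooth_quotient finiteDimensional_jacquet_quotient finrank_weightSpace_quotient_X
  finrank_weightSpace_quotient_Y_le finrank_weightSpace_quotient_Z finrank_weightSpace_quotient_eq_zero nontrivial_coinvariants_of_isConstituentOf_quotient
  isAdmissible_of_isConstituentOf_quotient)
open Summit.HodgeConjecture.HodgeConjecture.Cruxes.H413.K2E3GL3OneLinkNestedHighConstituentY (exists_constituent_Y_one)

namespace Summit.HodgeConjecture.HodgeConjecture.Cruxes.H413.K2E3GL3OneLinkNestedHighQuotient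

variable {F : Type} [Field F] [ValuativeRel F] [TopologicalSpace F] [IsNonarchimedeanLocalField F] (η : Fˣ →* ℂˣ)

/-- Arithmetic of the `Y`-column: `S = b + c ≤ 1 ⇒ b ≤ 1 ∧ c ≤ 1`. [folklore] -/
theorem le_one_and_le_one_of_eq_add {S b c : ℕ} (h : S = b + c) (hS : S ≤ 1) : b ≤ 1 ∧ c ≤ 1 := by omega

/-- Arithmetic of the `Z`-column: two even numbers summing to `2`, the first non-zero ⇒ the second is `0`. [folklore] -/
theorem eq_zero_of_even_add_even_eq_two {p q r s : ℕ} (hp : p = r + r) (hq : q = s + s) (h2 : p + q = 2) (hp0 : ¬ p = 0) : q = 0 := by omega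

/-- `b ≤ 1`, `b ≠ 1` ⇒ `b = 0`. [folklore] -/
theorem eq_zero_of_le_one_of_ne_one {b : ℕ} (h : b ≤ 1) (h1 : ¬ b = 1) : b = 0 := by omega

set_option maxHeartbeats 1600000 in  -- one long bookkeeping proof over large weight terms (cumulative budget, as in ★ IRR″-b)
/-- **§1 A PROPER NON-ZERO `N ≤ S₀` HAS A `{Y¹}`-PIECE**: `P = N` or `P = S₀ ⁄ N` has `mult_P Y = 1` and `mult_P ζ = 0` for every `ζ ≠ Y` (with its `r_B` finite-dimensional).
[cite: BernsteinZelevinsky1977, Cor. 2.13, Thm. 2.9] [cite: Zelevinsky1980, §1.6, Ex. 3.2] -/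
theorem exists_piece_Y_one (hη : IsOpen ((η.ker : Subgroup Fˣ) : Set Fˣ))
    (h3cell : ∀ c : Fin 3 → Fin 2, Monotone c → Function.Surjective c →
      ∀ (W : Type) [AddCommGroup W] [Module ℂ W] (σ : Representation ℂ (Π a : Fin 2, GL {i : Fin 3 // c i = a} F) W),
        σ.IsIrreducible → σ.IsSmooth → σ.IsSupercuspidal →
        ∀ (N : Subrepresentation (jacquetGL F c (Representation.parabolicIndGL F (id : Fin 3 → Fin 3) ((Representation.trivial ℂ (Π a : Fin 3, GL {i : Fin 3 // (id : Fin 3 → Fin 3) i = a} F) ℂ).twist (∏ a : Fin 3, ((![(η * ((unramifiedTwist F (1 / 2) : QuasiChar F).toMonoidHom)⁻¹), (η * ((unramifiedTwist F (1 / 2) : QuasiChar F).toMonoidHom)), (η * ((unramifiedTwist F (1 / 2) : QuasiChar F).toMonoidHom))] : Fin 3 → (Fˣ →* ℂˣ)) a).comp (Matrix.GeneralLinearGroup.det.comp (Pi.evalMonoidHom (fun a : Fin 3 => GL {i : Fin 3 // (id : Fin 3 → Fin 3) i = a} F) a)))))))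
          (q : N.toRepresentation.IntertwiningMap σ), q = 0)
    (Φ : (Representation.parabolicIndGL F (![false, false, true] : Fin 3 → Bool) ((Representation.trivial ℂ (Π a : Bool, GL {i : Fin 3 // (![false, false, true] : Fin 3 → Bool) i = a} F) ℂ).twist ((η.comp (Matrix.GeneralLinearGroup.det.comp (Pi.evalMonoidHom (fun a : Bool => GL {i : Fin 3 // (![false, false, true] : Fin 3 → Bool) i = a} F) false))) * ((η * ((unramifiedTwist F (1 / 2) : QuasiChar F).toMonoidHom)).comp (Matrix.GeneralLinearGroup.det.comp (Pi.evalMonoidHom (fun a : Bool => GL {i : Fin 3 // (![false, false, true] : Fin 3 → Bool) i = a} F) true)))))).IntertwiningMap (Representation.parabolicIndGL F (id : Fin 3 → Fin 3) ((Representation.trivial ℂ (Π a : Fin 3, GL {i : Fin 3 // (id : Fin 3 → Fin 3) i = a} F) ℂ).twist (∏ a : Fin 3, ((![(η * ((unramifiedTwist F (1 / 2) : QuasiChar F).toMonoidHom)⁻¹), (η * ((unramifiedTwist F (1 / 2) : QuasiChar F).toMonoidHom)), (η * ((unramifiedTwist F (1 / 2) : QuasiChar F).toMonoidHom))] : Fin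 3 → (Fˣ →* ℂˣ)) a).comp (Matrix.GeneralLinearGroup.det.comp (Pi.evalMonoidHom (fun a : Fin 3 => GL {i : Fin 3 // (id : Fin 3 → Fin 3) i = a} F) a)))))) (hΦ : Function.Injective Φ)
    (N : Subrepresentation Φ.range.quotientRep) (hbot : N ≠ ⊥) (htop : N ≠ ⊤) :
    (FiniteDimensional ℂ (restrictUnipotentGL F (id : Fin 3 → Fin 3) N.toRepresentation).Coinvariants ∧
      finrank ℂ ↥(⨅ m, Module.End.maxGenEigenspace (Representation.normalizedJacquetGL F (id : Fin 3 → Fin 3) N.toRepresentation m) (((∏ a : Fin 3, ((![(η * ((unramifiedTwist F (1 / 2) : QuasiChar F).toMonoidHom)), (η * ((unramifiedTwist F (1 / 2) : QuasiChar F).toMonoidHom)⁻¹), (η * ((unramifiedTwist F (1 / 2) : QuasiChar F).toMonoidHom))] : Fin 3 → (Fˣ →* ℂˣ)) a).comp (Matrix.GeneralLinearGroup.det.comp (Pi.evalMonoidHom (fun a : Fin 3 => GL {i : Fin 3 // (id : Fin 3 → Fin 3) i = a} F) a))) m : ℂˣ) : ℂ)) = 1 ∧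
      ∀ ζ : (Π a : Fin 3, GL {i : Fin 3 // (id : Fin 3 → Fin 3) i = a} F) → ℂ, ζ ≠ (fun m : (Π a : Fin 3, GL {i : Fin 3 // (id : Fin 3 → Fin 3) i = a} F) => (((∏ a : Fin 3, ((![(η * ((unramifiedTwist F (1 / 2) : QuasiChar F).toMonoidHom)), (η * ((unramifiedTwist F (1 / 2) : QuasiChar F).toMonoidHom)⁻¹), (η * ((unramifiedTwist F (1 / 2) : QuasiChar F).toMonoidHom))] : Fin 3 → (Fˣ →* ℂˣ)) a).comp (Matrix.GeneralLinearGroup.det.comp (Pi.evalMonoidHom (fun a : Fin 3 => GL {i : Fin 3 // (id : Fin 3 → Fin 3) i = a} F) a))) m : ℂˣ) : ℂ)) → finrank ℂ ↥(⨅ m, Module.End.maxGenEigenspace (Representation.normalizedJacquetGL F (id : Fin 3 → Fin 3) N.toRepresentation m) (ζ m)) = 0) ∨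
    (FiniteDimensional ℂ (restrictUnipotentGL F (id : Fin 3 → Fin 3) N.quotientRep).Coinvariants ∧
      finrank ℂ ↥(⨅ m, Module.End.maxGenEigenspace (Representation.normalizedJacquetGL F (id : Fin 3 → Fin 3) N.quotientRep m) (((∏ a : Fin 3, ((![(η * ((unramifiedTwist F (1 / 2) : QuasiChar F).toMonoidHom)), (η * ((unramifiedTwist F (1 / 2) : QuasiChar F).toMonoidHom)⁻¹), (η * ((unramifiedTwist F (1 / 2) : QuasiChar F).toMonoidHom))] : Fin 3 → (Fˣ →* ℂˣ)) a).comp (Matrix.GeneralLinearGroup.det.comp (Pi.evalMonoidHom (fun a : Fin 3 => GL {i : Fin 3 // (id : Fin 3 → Fin 3) i = a} F) a))) m : ℂˣ) : ℂ)) = 1 ∧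
      ∀ ζ : (Π a : Fin 3, GL {i : Fin 3 // (id : Fin 3 → Fin 3) i = a} F) → ℂ, ζ ≠ (fun m : (Π a : Fin 3, GL {i : Fin 3 // (id : Fin 3 → Fin 3) i = a} F) => (((∏ a : Fin 3, ((![(η * ((unramifiedTwist F (1 / 2) : QuasiChar F).toMonoidHom)), (η * ((unramifiedTwist F (1 / 2) : QuasiChar F).toMonoidHom)⁻¹), (η * ((unramifiedTwist F (1 / 2) : QuasiChar F).toMonoidHom))] : Fin 3 → (Fˣ →* ℂˣ)) a).comp (Matrix.GeneralLinearGroup.det.comp (Pi.evalMonoidHom (fun a : Fin 3 => GL {i : Fin 3 // (id : Fin 3 → Fin 3) i = a} F) a))) m : ℂˣ) : ℂ)) → finrank ℂ ↥(⨅ m, Module.End.maxGenEigenspace (Representation.normalizedJacquetGL F (id : Fin 3 → Fin 3) N.quotientRep m) (ζ m)) = 0) := by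
  have hS := isSmooth_quotient η Φ
  haveI hfd := finiteDimensional_jacquet_quotient η hη Φ
  haveI hfdN : FiniteDimensional ℂ (restrictUnipotentGL F (id : Fin 3 → Fin 3) N.toRepresentation).Coinvariants :=
    finiteDimensional_jacquet_subrepresentation _ monotone_id hS N
  haveI hfdQ : FiniteDimensional ℂ (restrictUnipotentGL F (id : Fin 3 → Fin 3) N.quotientRep).Coinvariants := finiteDimensional_jacquet_quotientRep _ N
  have hJ := nontrivial_coinvariants_of_isConstituentOf_quotient η h3cell Φ
  -- additivity at every weight, and the `S₀`-table (no `rw` across the big weight lambdas)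
  have hadd := fun ζ => finrank_weightSpace_eq_add_subrepresentation _ hS N ζ
  have hvX := finrank_weightSpace_quotient_X η hη Φ hΦ
  have hvY := finrank_weightSpace_quotient_Y_le η hη Φ hΦ
  have hvZ := finrank_weightSpace_quotient_Z η hη Φ hΦ
  have hsumX := (hadd (fun m : (Π a : Fin 3, GL {i : Fin 3 // (id : Fin 3 → Fin 3) i = a} F) => (((∏ a : Fin 3, ((![(η * ((unramifiedTwist F (1 / 2) : QuasiChar F).toMonoidHom)⁻¹), (η * ((unramifiedTwist F (1 / 2) : QuasiChar F).toMonoidHom)), (η * ((unramifiedTwist F (1 / 2) : QuasiChar F).toMonoidHom))] : Fin 3 → (Fˣ →* ℂˣ)) a).comp (Matrix.GeneralLinearGroup.det.comp (Pi.evalMonoidHom (fun a : Fin 3 => GL {i : Fin 3 // (id : Fin 3 → Fin 3) i = a} F) a))) m : ℂˣ) : ℂ))).symm.trans hvX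
  beta_reduce at hsumX
  have hNX : finrank ℂ ↥(⨅ m, Module.End.maxGenEigenspace (Representation.normalizedJacquetGL F (id : Fin 3 → Fin 3) N.toRepresentation m) (((∏ a : Fin 3, ((![(η * ((unramifiedTwist F (1 / 2) : QuasiChar F).toMonoidHom)⁻¹), (η * ((unramifiedTwist F (1 / 2) : QuasiChar F).toMonoidHom)), (η * ((unramifiedTwist F (1 / 2) : QuasiChar F).toMonoidHom))] : Fin 3 → (Fˣ →* ℂˣ)) a).comp (Matrix.GeneralLinearGroup.det.comp (Pi.evalMonoidHom (fun a : Fin 3 => GL {i : Fin 3 // (id : Fin 3 → Fin 3) i = a} F) a))) m : ℂˣ) : ℂ)) = 0 := Nat.eq_zero_of_add_eq_zero_right hsumX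
  have hQX : finrank ℂ ↥(⨅ m, Module.End.maxGenEigenspace (Representation.normalizedJacquetGL F (id : Fin 3 → Fin 3) N.quotientRep m) (((∏ a : Fin 3, ((![(η * ((unramifiedTwist F (1 / 2) : QuasiChar F).toMonoidHom)⁻¹), (η * ((unramifiedTwist F (1 / 2) : QuasiChar F).toMonoidHom)), (η * ((unramifiedTwist F (1 / 2) : QuasiChar F).toMonoidHom))] : Fin 3 → (Fˣ →* ℂˣ)) a).comp (Matrix.GeneralLinearGroup.det.comp (Pi.evalMonoidHom (fun a : Fin 3 => GL {i : Fin 3 // (id : Fin 3 → Fin 3) i = a} F) a))) m : ℂˣ) : ℂ)) = 0 := Nat.eq_zero_of_add_eq_zero_left hsumX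
  have hsumY := hadd (fun m : (Π a : Fin 3, GL {i : Fin 3 // (id : Fin 3 → Fin 3) i = a} F) => (((∏ a : Fin 3, ((![(η * ((unramifiedTwist F (1 / 2) : QuasiChar F).toMonoidHom)), (η * ((unramifiedTwist F (1 / 2) : QuasiChar F).toMonoidHom)⁻¹), (η * ((unramifiedTwist F (1 / 2) : QuasiChar F).toMonoidHom))] : Fin 3 → (Fˣ →* ℂˣ)) a).comp (Matrix.GeneralLinearGroup.det.comp (Pi.evalMonoidHom (fun a : Fin 3 => GL {i : Fin 3 // (id : Fin 3 → Fin 3) i = a} F) a))) m : ℂˣ) : ℂ))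
  beta_reduce at hsumY
  have hsumY' : finrank ℂ ↥(⨅ m, Module.End.maxGenEigenspace (Representation.normalizedJacquetGL F (id : Fin 3 → Fin 3) Φ.range.quotientRep m) (((∏ a : Fin 3, ((![(η * ((unramifiedTwist F (1 / 2) : QuasiChar F).toMonoidHom)), (η * ((unramifiedTwist F (1 / 2) : QuasiChar F).toMonoidHom)⁻¹), (η * ((unramifiedTwist F (1 / 2) : QuasiChar F).toMonoidHom))] : Fin 3 → (Fˣ →* ℂˣ)) a).comp (Matrix.GeneralLinearGroup.det.comp (Pi.evalMonoidHom (fun a : Fin 3 => GL {i : Fin 3 // (id : Fin 3 → Fin 3) i = a} F) a))) m : ℂˣ) : ℂ)) = finrank ℂ ↥(⨅ m, Module.End.maxGenEigenspace (Representation.normalizedJacquetGL F (id : Fin 3 → Fin 3) N.toRepresentation m) (((∏ a : Fin 3, ((![(η * ((unramifiedTwist F (1 / 2) : QuasiChar F).toMonoidHom)), (η * ((unramifiedTwist F (1 / 2) : QuasiChar F).toMonoidHom)⁻¹), (η * ((unramifiedTwist F (1 / 2) : QuasiChar F).toMonoidHom))] : Fin 3 → (Fˣ →* ℂˣ)) a).comp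 (Matrix.GeneralLinearGroup.det.comp (Pi.evalMonoidHom (fun a : Fin 3 => GL {i : Fin 3 // (id : Fin 3 → Fin 3) i = a} F) a))) m : ℂˣ) : ℂ)) + finrank ℂ ↥(⨅ m, Module.End.maxGenEigenspace (Representation.normalizedJacquetGL F (id : Fin 3 → Fin 3) N.quotientRep m) (((∏ a : Fin 3, ((![(η * ((unramifiedTwist F (1 / 2) : QuasiChar F).toMonoidHom)), (η * ((unramifiedTwist F (1 / 2) : QuasiChar F).toMonoidHom)⁻¹), (η * ((unramifiedTwist F (1 / 2) : QuasiChar F).toMonoidHom))] : Fin 3 → (Fˣ →* ℂˣ)) a).comp (Matrix.GeneralLinearGroup.det.comp (Pi.evalMonoidHom (fun a : Fin 3 => GL {i : Fin 3 // (id : Fin 3 → Fin 3) i = a} F) a))) m : ℂˣ) : ℂ)) := hsumY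
  have hNY : finrank ℂ ↥(⨅ m, Module.End.maxGenEigenspace (Representation.normalizedJacquetGL F (id : Fin 3 → Fin 3) N.toRepresentation m) (((∏ a : Fin 3, ((![(η * ((unramifiedTwist F (1 / 2) : QuasiChar F).toMonoidHom)), (η * ((unramifiedTwist F (1 / 2) : QuasiChar F).toMonoidHom)⁻¹), (η * ((unramifiedTwist F (1 / 2) : QuasiChar F).toMonoidHom))] : Fin 3 → (Fˣ →* ℂˣ)) a).comp (Matrix.GeneralLinearGroup.det.comp (Pi.evalMonoidHom (fun a : Fin 3 => GL {i : Fin 3 // (id : Fin 3 → Fin 3) i = a} F) a))) m : ℂˣ) : ℂ)) ≤ 1 := (le_one_and_le_one_of_eq_add hsumY' hvY).1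
  have hQY : finrank ℂ ↥(⨅ m, Module.End.maxGenEigenspace (Representation.normalizedJacquetGL F (id : Fin 3 → Fin 3) N.quotientRep m) (((∏ a : Fin 3, ((![(η * ((unramifiedTwist F (1 / 2) : QuasiChar F).toMonoidHom)), (η * ((unramifiedTwist F (1 / 2) : QuasiChar F).toMonoidHom)⁻¹), (η * ((unramifiedTwist F (1 / 2) : QuasiChar F).toMonoidHom))] : Fin 3 → (Fˣ →* ℂˣ)) a).comp (Matrix.GeneralLinearGroup.det.comp (Pi.evalMonoidHom (fun a : Fin 3 => GL {i : Fin 3 // (id : Fin 3 → Fin 3) i = a} F) a))) m : ℂˣ) : ℂ)) ≤ 1 := (le_one_and_le_one_of_eq_add hsumY' hvY).2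
  have hsumZ := (hadd (fun m : (Π a : Fin 3, GL {i : Fin 3 // (id : Fin 3 → Fin 3) i = a} F) => (((∏ a : Fin 3, ((![(η * ((unramifiedTwist F (1 / 2) : QuasiChar F).toMonoidHom)), (η * ((unramifiedTwist F (1 / 2) : QuasiChar F).toMonoidHom)), (η * ((unramifiedTwist F (1 / 2) : QuasiChar F).toMonoidHom)⁻¹)] : Fin 3 → (Fˣ →* ℂˣ)) a).comp (Matrix.GeneralLinearGroup.det.comp (Pi.evalMonoidHom (fun a : Fin 3 => GL {i : Fin 3 // (id : Fin 3 → Fin 3) i = a} F) a))) m : ℂˣ) : ℂ))).symm.trans hvZ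
  beta_reduce at hsumZ
  have hsumZ' : finrank ℂ ↥(⨅ m, Module.End.maxGenEigenspace (Representation.normalizedJacquetGL F (id : Fin 3 → Fin 3) N.toRepresentation m) (((∏ a : Fin 3, ((![(η * ((unramifiedTwist F (1 / 2) : QuasiChar F).toMonoidHom)), (η * ((unramifiedTwist F (1 / 2) : QuasiChar F).toMonoidHom)), (η * ((unramifiedTwist F (1 / 2) : QuasiChar F).toMonoidHom)⁻¹)] : Fin 3 → (Fˣ →* ℂˣ)) a).comp (Matrix.GeneralLinearGroup.det.comp (Pi.evalMonoidHom (fun a : Fin 3 => GL {i : Fin 3 // (id : Fin 3 → Fin 3) i = a} F) a))) m : ℂˣ) : ℂ)) + finrank ℂ ↥(⨅ m, Module.End.maxGenEigenspace (Representation.normalizedJacquetGL F (id : Fin 3 → Fin 3) N.quotientRep m) (((∏ a : Fin 3, ((![(η * ((unramifiedTwist F (1 / 2) : QuasiChar F).toMonoidHom)), (η * ((unramifiedTwist F (1 / 2) : QuasiChar F).toMonoidHom)), (η * ((unramifiedTwist F (1 / 2) : QuasiChar F).toMonoidHom)⁻¹)] : Fin 3 → (Fˣ →* ℂˣ)) a).comp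 (Matrix.GeneralLinearGroup.det.comp (Pi.evalMonoidHom (fun a : Fin 3 => GL {i : Fin 3 // (id : Fin 3 → Fin 3) i = a} F) a))) m : ℂˣ) : ℂ)) = 2 := hsumZ
  have h0 : ∀ ζ : (Π a : Fin 3, GL {i : Fin 3 // (id : Fin 3 → Fin 3) i = a} F) → ℂ, ζ ≠ (fun m : (Π a : Fin 3, GL {i : Fin 3 // (id : Fin 3 → Fin 3) i = a} F) => (((∏ a : Fin 3, ((![(η * ((unramifiedTwist F (1 / 2) : QuasiChar F).toMonoidHom)⁻¹), (η * ((unramifiedTwist F (1 / 2) : QuasiChar F).toMonoidHom)), (η * ((unramifiedTwist F (1 / 2) : QuasiChar F).toMonoidHom))] : Fin 3 → (Fˣ →* ℂˣ)) a).comp (Matrix.GeneralLinearGroup.det.comp (Pi.evalMonoidHom (fun a : Fin 3 => GL {i : Fin 3 // (id : Fin 3 → Fin 3) i = a} F) a))) m : ℂˣ) : ℂ)) → ζ ≠ (fun m : (Π a : Fin 3, GL {i : Fin 3 // (id : Fin 3 → Fin 3) i = a} F) => (((∏ a : Fin 3, ((![(η * ((unramifiedTwist F (1 / 2) : QuasiChar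 F).toMonoidHom)), (η * ((unramifiedTwist F (1 / 2) : QuasiChar F).toMonoidHom)⁻¹), (η * ((unramifiedTwist F (1 / 2) : QuasiChar F).toMonoidHom))] : Fin 3 → (Fˣ →* ℂˣ)) a).comp (Matrix.GeneralLinearGroup.det.comp (Pi.evalMonoidHom (fun a : Fin 3 => GL {i : Fin 3 // (id : Fin 3 → Fin 3) i = a} F) a))) m : ℂˣ) : ℂ)) → ζ ≠ (fun m : (Π a : Fin 3, GL {i : Fin 3 // (id : Fin 3 → Fin 3) i = a} F) => (((∏ a : Fin 3, ((![(η * ((unramifiedTwist F (1 / 2) : QuasiChar F).toMonoidHom)), (η * ((unramifiedTwist F (1 / 2) : QuasiChar F).toMonoidHom)), (η * ((unramifiedTwist F (1 / 2) : QuasiChar F).toMonoidHom)⁻¹)] : Fin 3 → (Fˣ →* ℂˣ)) a).comp (Matrix.GeneralLinearGroup.det.comp (Pi.evalMonoidHom (fun a : Fin 3 => GL {i : Fin 3 // (id : Fin 3 → Fin 3) i = a} F) a))) m : ℂˣ) : ℂ)) →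
      finrank ℂ ↥(⨅ m, Module.End.maxGenEigenspace (Representation.normalizedJacquetGL F (id : Fin 3 → Fin 3) N.toRepresentation m) (ζ m)) = 0 ∧ finrank ℂ ↥(⨅ m, Module.End.maxGenEigenspace (Representation.normalizedJacquetGL F (id : Fin 3 → Fin 3) N.quotientRep m) (ζ m)) = 0 := by
    intro ζ h1 h2 h3
    have hv := finrank_weightSpace_quotient_eq_zero η hη Φ hΦ ζ h1 h2 h3
    have hsum := (hadd ζ).symm.trans hv
    exact ⟨Nat.eq_zero_of_add_eq_zero_right hsum, Nat.eq_zero_of_add_eq_zero_left hsum⟩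
  -- parity of the `Z`-multiplicities of the two pieces (`Z = tch(aν, aν, a)`, `I₂(aν, aν)` irreducible)
  have hb : IsOpen ((((η * ((unramifiedTwist F (1 / 2) : QuasiChar F).toMonoidHom))).ker : Subgroup Fˣ) : Set Fˣ) := isOpen_ker_b η hη
  haveI : IsTopologicalRing F := inferInstance
  have hirr2 := isIrreducible_parabolicIndGL_two_self (η * ((unramifiedTwist F (1 / 2) : QuasiChar F).toMonoidHom)) (continuous_unitsCoe_of_isOpen_ker _ hb)
  have hevN := even_finrank_weightSpace₀₁ N.toRepresentation (hS.toRepresentation N) (η * ((unramifiedTwist F (1 / 2) : QuasiChar F).toMonoidHom)) (η * ((unramifiedTwist F (1 / 2) : QuasiChar F).toMonoidHom)⁻¹) hb hirr2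
  have hevQ := even_finrank_weightSpace₀₁ N.quotientRep (hS.quotientRep N) (η * ((unramifiedTwist F (1 / 2) : QuasiChar F).toMonoidHom)) (η * ((unramifiedTwist F (1 / 2) : QuasiChar F).toMonoidHom)⁻¹) hb hirr2
  obtain ⟨nN, hnN⟩ := hevN
  obtain ⟨nQ, hnQ⟩ := hevQ
  have hnN' : finrank ℂ ↥(⨅ m, Module.End.maxGenEigenspace (Representation.normalizedJacquetGL F (id : Fin 3 → Fin 3) N.toRepresentation m) (((∏ a : Fin 3, ((![(η * ((unramifiedTwist F (1 / 2) : QuasiChar F).toMonoidHom)), (η * ((unramifiedTwist F (1 / 2) : QuasiChar F).toMonoidHom)), (η * ((unramifiedTwist F (1 / 2) : QuasiChar F).toMonoidHom)⁻¹)] : Fin 3 → (Fˣ →* ℂˣ)) a).comp (Matrix.GeneralLinearGroup.det.comp (Pi.evalMonoidHom (fun a : Fin 3 => GL {i : Fin 3 // (id : Fin 3 → Fin 3) i = a} F) a))) m : ℂˣ) : ℂ)) = nN + nN := hnN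
  have hnQ' : finrank ℂ ↥(⨅ m, Module.End.maxGenEigenspace (Representation.normalizedJacquetGL F (id : Fin 3 → Fin 3) N.quotientRep m) (((∏ a : Fin 3, ((![(η * ((unramifiedTwist F (1 / 2) : QuasiChar F).toMonoidHom)), (η * ((unramifiedTwist F (1 / 2) : QuasiChar F).toMonoidHom)), (η * ((unramifiedTwist F (1 / 2) : QuasiChar F).toMonoidHom)⁻¹)] : Fin 3 → (Fˣ →* ℂˣ)) a).comp (Matrix.GeneralLinearGroup.det.comp (Pi.evalMonoidHom (fun a : Fin 3 => GL {i : Fin 3 // (id : Fin 3 → Fin 3) i = a} F) a))) m : ℂˣ) : ℂ)) = nQ + nQ := hnQ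
  -- no piece is weightless
  have hNw := exists_finrank_weightSpace_ne_zero_of_ne_bot _ hS hJ N hbot
  have hQw := exists_finrank_weightSpace_quotientRep_ne_zero _ hS hJ N htop
  obtain ⟨ζN, hζN⟩ := hNw
  obtain ⟨ζQ, hζQ⟩ := hQw
  by_cases hNZ : finrank ℂ ↥(⨅ m, Module.End.maxGenEigenspace (Representation.normalizedJacquetGL F (id : Fin 3 → Fin 3) N.toRepresentation m) (((∏ a : Fin 3, ((![(η * ((unramifiedTwist F (1 / 2) : QuasiChar F).toMonoidHom)), (η * ((unramifiedTwist F (1 / 2) : QuasiChar F).toMonoidHom)), (η * ((unramifiedTwist F (1 / 2) : QuasiChar F).toMonoidHom)⁻¹)] : Fin 3 → (Fˣ →* ℂˣ)) a).comp (Matrix.GeneralLinearGroup.det.comp (Pi.evalMonoidHom (fun a : Fin 3 => GL {i : Fin 3 // (id : Fin 3 → Fin 3) i = a} F) a))) m : ℂˣ) : ℂ)) = 0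
  · -- `N` is `Z`-free: its weight is `Y`, of multiplicity exactly one, and it has no other weight
    left
    refine ⟨hfdN, ?_, fun ζ hζ => ?_⟩
    · by_contra hNY1
      have hNY0 : finrank ℂ ↥(⨅ m, Module.End.maxGenEigenspace (Representation.normalizedJacquetGL F (id : Fin 3 → Fin 3) N.toRepresentation m) (((∏ a : Fin 3, ((![(η * ((unramifiedTwist F (1 / 2) : QuasiChar F).toMonoidHom)), (η * ((unramifiedTwist F (1 / 2) : QuasiChar F).toMonoidHom)⁻¹), (η * ((unramifiedTwist F (1 / 2) : QuasiChar F).toMonoidHom))] : Fin 3 → (Fˣ →* ℂˣ)) a).comp (Matrix.GeneralLinearGroup.det.comp (Pi.evalMonoidHom (fun a : Fin 3 => GL {i : Fin 3 // (id : Fin 3 → Fin 3) i = a} F) a))) m : ℂˣ) : ℂ)) = 0 := eq_zero_of_le_one_of_ne_one hNY hNY1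
      apply hζN
      by_cases h1 : ζN = (fun m : (Π a : Fin 3, GL {i : Fin 3 // (id : Fin 3 → Fin 3) i = a} F) => (((∏ a : Fin 3, ((![(η * ((unramifiedTwist F (1 / 2) : QuasiChar F).toMonoidHom)⁻¹), (η * ((unramifiedTwist F (1 / 2) : QuasiChar F).toMonoidHom)), (η * ((unramifiedTwist F (1 / 2) : QuasiChar F).toMonoidHom))] : Fin 3 → (Fˣ →* ℂˣ)) a).comp (Matrix.GeneralLinearGroup.det.comp (Pi.evalMonoidHom (fun a : Fin 3 => GL {i : Fin 3 // (id : Fin 3 → Fin 3) i = a} F) a))) m : ℂˣ) : ℂ))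
      · subst h1
        exact hNX
      by_cases h2 : ζN = (fun m : (Π a : Fin 3, GL {i : Fin 3 // (id : Fin 3 → Fin 3) i = a} F) => (((∏ a : Fin 3, ((![(η * ((unramifiedTwist F (1 / 2) : QuasiChar F).toMonoidHom)), (η * ((unramifiedTwist F (1 / 2) : QuasiChar F).toMonoidHom)⁻¹), (η * ((unramifiedTwist F (1 / 2) : QuasiChar F).toMonoidHom))] : Fin 3 → (Fˣ →* ℂˣ)) a).comp (Matrix.GeneralLinearGroup.det.comp (Pi.evalMonoidHom (fun a : Fin 3 => GL {i : Fin 3 // (id : Fin 3 → Fin 3) i = a} F) a))) m : ℂˣ) : ℂ))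
      · subst h2
        exact hNY0
      by_cases h3 : ζN = (fun m : (Π a : Fin 3, GL {i : Fin 3 // (id : Fin 3 → Fin 3) i = a} F) => (((∏ a : Fin 3, ((![(η * ((unramifiedTwist F (1 / 2) : QuasiChar F).toMonoidHom)), (η * ((unramifiedTwist F (1 / 2) : QuasiChar F).toMonoidHom)), (η * ((unramifiedTwist F (1 / 2) : QuasiChar F).toMonoidHom)⁻¹)] : Fin 3 → (Fˣ →* ℂˣ)) a).comp (Matrix.GeneralLinearGroup.det.comp (Pi.evalMonoidHom (fun a : Fin 3 => GL {i : Fin 3 // (id : Fin 3 → Fin 3) i = a} F) a))) m : ℂˣ) : ℂ))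
      · subst h3
        exact hNZ
      exact (h0 ζN h1 h2 h3).1
    · by_cases h1 : ζ = (fun m : (Π a : Fin 3, GL {i : Fin 3 // (id : Fin 3 → Fin 3) i = a} F) => (((∏ a : Fin 3, ((![(η * ((unramifiedTwist F (1 / 2) : QuasiChar F).toMonoidHom)⁻¹), (η * ((unramifiedTwist F (1 / 2) : QuasiChar F).toMonoidHom)), (η * ((unramifiedTwist F (1 / 2) : QuasiChar F).toMonoidHom))] : Fin 3 → (Fˣ →* ℂˣ)) a).comp (Matrix.GeneralLinearGroup.det.comp (Pi.evalMonoidHom (fun a : Fin 3 => GL {i : Fin 3 // (id : Fin 3 → Fin 3) i = a} F) a))) m : ℂˣ) : ℂ))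
      · subst h1
        exact hNX
      by_cases h3 : ζ = (fun m : (Π a : Fin 3, GL {i : Fin 3 // (id : Fin 3 → Fin 3) i = a} F) => (((∏ a : Fin 3, ((![(η * ((unramifiedTwist F (1 / 2) : QuasiChar F).toMonoidHom)), (η * ((unramifiedTwist F (1 / 2) : QuasiChar F).toMonoidHom)), (η * ((unramifiedTwist F (1 / 2) : QuasiChar F).toMonoidHom)⁻¹)] : Fin 3 → (Fˣ →* ℂˣ)) a).comp (Matrix.GeneralLinearGroup.det.comp (Pi.evalMonoidHom (fun a : Fin 3 => GL {i : Fin 3 // (id : Fin 3 → Fin 3) i = a} F) a))) m : ℂˣ) : ℂ))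
      · subst h3
        exact hNZ
      exact (h0 ζ h1 hζ h3).1
  · -- otherwise `S₀ ⁄ N` is `Z`-free (both `Z`-multiplicities are even and sum to `2`)
    right
    have hQZ : finrank ℂ ↥(⨅ m, Module.End.maxGenEigenspace (Representation.normalizedJacquetGL F (id : Fin 3 → Fin 3) N.quotientRep m) (((∏ a : Fin 3, ((![(η * ((unramifiedTwist F (1 / 2) : QuasiChar F).toMonoidHom)), (η * ((unramifiedTwist F (1 / 2) : QuasiChar F).toMonoidHom)), (η * ((unramifiedTwist F (1 / 2) : QuasiChar F).toMonoidHom)⁻¹)] : Fin 3 → (Fˣ →* ℂˣ)) a).comp (Matrix.GeneralLinearGroup.det.comp (Pi.evalMonoidHom (fun a : Fin 3 => GL {i : Fin 3 // (id : Fin 3 → Fin 3) i = a} F) a))) m : ℂˣ) : ℂ)) = 0 := eq_zero_of_even_add_even_eq_two hnN' hnQ' hsumZ' hNZ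
    refine ⟨hfdQ, ?_, fun ζ hζ => ?_⟩
    · by_contra hQY1
      have hQY0 : finrank ℂ ↥(⨅ m, Module.End.maxGenEigenspace (Representation.normalizedJacquetGL F (id : Fin 3 → Fin 3) N.quotientRep m) (((∏ a : Fin 3, ((![(η * ((unramifiedTwist F (1 / 2) : QuasiChar F).toMonoidHom)), (η * ((unramifiedTwist F (1 / 2) : QuasiChar F).toMonoidHom)⁻¹), (η * ((unramifiedTwist F (1 / 2) : QuasiChar F).toMonoidHom))] : Fin 3 → (Fˣ →* ℂˣ)) a).comp (Matrix.GeneralLinearGroup.det.comp (Pi.evalMonoidHom (fun a : Fin 3 => GL {i : Fin 3 // (id : Fin 3 → Fin 3) i = a} F) a))) m : ℂˣ) : ℂ)) = 0 := eq_zero_of_le_one_of_ne_one hQY hQY1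
      apply hζQ
      by_cases h1 : ζQ = (fun m : (Π a : Fin 3, GL {i : Fin 3 // (id : Fin 3 → Fin 3) i = a} F) => (((∏ a : Fin 3, ((![(η * ((unramifiedTwist F (1 / 2) : QuasiChar F).toMonoidHom)⁻¹), (η * ((unramifiedTwist F (1 / 2) : QuasiChar F).toMonoidHom)), (η * ((unramifiedTwist F (1 / 2) : QuasiChar F).toMonoidHom))] : Fin 3 → (Fˣ →* ℂˣ)) a).comp (Matrix.GeneralLinearGroup.det.comp (Pi.evalMonoidHom (fun a : Fin 3 => GL {i : Fin 3 // (id : Fin 3 → Fin 3) i = a} F) a))) m : ℂˣ) : ℂ))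
      · subst h1
        exact hQX
      by_cases h2 : ζQ = (fun m : (Π a : Fin 3, GL {i : Fin 3 // (id : Fin 3 → Fin 3) i = a} F) => (((∏ a : Fin 3, ((![(η * ((unramifiedTwist F (1 / 2) : QuasiChar F).toMonoidHom)), (η * ((unramifiedTwist F (1 / 2) : QuasiChar F).toMonoidHom)⁻¹), (η * ((unramifiedTwist F (1 / 2) : QuasiChar F).toMonoidHom))] : Fin 3 → (Fˣ →* ℂˣ)) a).comp (Matrix.GeneralLinearGroup.det.comp (Pi.evalMonoidHom (fun a : Fin 3 => GL {i : Fin 3 // (id : Fin 3 → Fin 3) i = a} F) a))) m : ℂˣ) : ℂ))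
      · subst h2
        exact hQY0
      by_cases h3 : ζQ = (fun m : (Π a : Fin 3, GL {i : Fin 3 // (id : Fin 3 → Fin 3) i = a} F) => (((∏ a : Fin 3, ((![(η * ((unramifiedTwist F (1 / 2) : QuasiChar F).toMonoidHom)), (η * ((unramifiedTwist F (1 / 2) : QuasiChar F).toMonoidHom)), (η * ((unramifiedTwist F (1 / 2) : QuasiChar F).toMonoidHom)⁻¹)] : Fin 3 → (Fˣ →* ℂˣ)) a).comp (Matrix.GeneralLinearGroup.det.comp (Pi.evalMonoidHom (fun a : Fin 3 => GL {i : Fin 3 // (id : Fin 3 → Fin 3) i = a} F) a))) m : ℂˣ) : ℂ))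
      · subst h3
        exact hQZ
      exact (h0 ζQ h1 h2 h3).2
    · by_cases h1 : ζ = (fun m : (Π a : Fin 3, GL {i : Fin 3 // (id : Fin 3 → Fin 3) i = a} F) => (((∏ a : Fin 3, ((![(η * ((unramifiedTwist F (1 / 2) : QuasiChar F).toMonoidHom)⁻¹), (η * ((unramifiedTwist F (1 / 2) : QuasiChar F).toMonoidHom)), (η * ((unramifiedTwist F (1 / 2) : QuasiChar F).toMonoidHom))] : Fin 3 → (Fˣ →* ℂˣ)) a).comp (Matrix.GeneralLinearGroup.det.comp (Pi.evalMonoidHom (fun a : Fin 3 => GL {i : Fin 3 // (id : Fin 3 → Fin 3) i = a} F) a))) m : ℂˣ) : ℂ))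
      · subst h1
        exact hQX
      by_cases h3 : ζ = (fun m : (Π a : Fin 3, GL {i : Fin 3 // (id : Fin 3 → Fin 3) i = a} F) => (((∏ a : Fin 3, ((![(η * ((unramifiedTwist F (1 / 2) : QuasiChar F).toMonoidHom)), (η * ((unramifiedTwist F (1 / 2) : QuasiChar F).toMonoidHom)), (η * ((unramifiedTwist F (1 / 2) : QuasiChar F).toMonoidHom)⁻¹)] : Fin 3 → (Fˣ →* ℂˣ)) a).comp (Matrix.GeneralLinearGroup.det.comp (Pi.evalMonoidHom (fun a : Fin 3 => GL {i : Fin 3 // (id : Fin 3 → Fin 3) i = a} F) a))) m : ℂˣ) : ℂ))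
      · subst h3
        exact hQZ
      exact (h0 ζ h1 hζ h3).2

set_option maxHeartbeats 800000 in  -- large weight terms: cumulative elaboration budget (as in ★ Ambient §2)
/-- **§2 `S₀ = I(X) ⁄ Φ(D″)` IS IRREDUCIBLE** (modulo `h3cell` and `hNYA`): `S₀ ≠ 0` carries `Z²`; a proper non-zero subrepresentation would produce a `{Y¹}`-piece (§1), an
irreducible admissible constituent `r` with `E(r) = {Y¹}` (★ `exists_constituent_Y_one`, ★ Ambient), against `hNYA`.
[cite: BernsteinZelevinsky1977, Cor. 2.13, Thm. 2.9] [cite: Zelevinsky1980, §1.6, Ex. 3.2, Thm. 6.1] [cite: Casselman1995, Cor. 7.1.2] -/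
theorem isIrreducible_quotient (hη : IsOpen ((η.ker : Subgroup Fˣ) : Set Fˣ))
    (h3cell : ∀ c : Fin 3 → Fin 2, Monotone c → Function.Surjective c →
      ∀ (W : Type) [AddCommGroup W] [Module ℂ W] (σ : Representation ℂ (Π a : Fin 2, GL {i : Fin 3 // c i = a} F) W),
        σ.IsIrreducible → σ.IsSmooth → σ.IsSupercuspidal →
        ∀ (N : Subrepresentation (jacquetGL F c (Representation.parabolicIndGL F (id : Fin 3 → Fin 3) ((Representation.trivial ℂ (Π a : Fin 3, GL {i : Fin 3 // (id : Fin 3 → Fin 3) i = a} F) ℂ).twist (∏ a : Fin 3, ((![(η * ((unramifiedTwist F (1 / 2) : QuasiChar F).toMonoidHom)⁻¹), (η * ((unramifiedTwist F (1 / 2) : QuasiChar F).toMonoidHom)), (η * ((unramifiedTwist F (1 / 2) : QuasiChar F).toMonoidHom))] : Fin 3 → (Fˣ →* ℂˣ)) a).comp (Matrix.GeneralLinearGroup.det.comp (Pi.evalMonoidHom (fun a : Fin 3 => GL {i : Fin 3 // (id : Fin 3 → Fin 3) i = a} F) a)))))))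
          (q : N.toRepresentation.IntertwiningMap σ), q = 0)
    (hNYA : ∀ (r : SmoothIrrep (GL (Fin 3) F)), r.ρ.IsAdmissible → ∀ [FiniteDimensional ℂ (restrictUnipotentGL F (id : Fin 3 → Fin 3) r.ρ).Coinvariants],
      finrank ℂ ↥(⨅ m, Module.End.maxGenEigenspace (Representation.normalizedJacquetGL F (id : Fin 3 → Fin 3) r.ρ m) (((∏ a : Fin 3, ((![(η * ((unramifiedTwist F (1 / 2) : QuasiChar F).toMonoidHom)), (η * ((unramifiedTwist F (1 / 2) : QuasiChar F).toMonoidHom)⁻¹), (η * ((unramifiedTwist F (1 / 2) : QuasiChar F).toMonoidHom))] : Fin 3 → (Fˣ →* ℂˣ)) a).comp (Matrix.GeneralLinearGroup.det.comp (Pi.evalMonoidHom (fun a : Fin 3 => GL {i : Fin 3 // (id : Fin 3 → Fin 3) i = a} F) a))) m : ℂˣ) : ℂ)) = 1 →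
      (∀ ζ : (Π a : Fin 3, GL {i : Fin 3 // (id : Fin 3 → Fin 3) i = a} F) → ℂ, ζ ≠ (fun m : (Π a : Fin 3, GL {i : Fin 3 // (id : Fin 3 → Fin 3) i = a} F) => (((∏ a : Fin 3, ((![(η * ((unramifiedTwist F (1 / 2) : QuasiChar F).toMonoidHom)), (η * ((unramifiedTwist F (1 / 2) : QuasiChar F).toMonoidHom)⁻¹), (η * ((unramifiedTwist F (1 / 2) : QuasiChar F).toMonoidHom))] : Fin 3 → (Fˣ →* ℂˣ)) a).comp (Matrix.GeneralLinearGroup.det.comp (Pi.evalMonoidHom (fun a : Fin 3 => GL {i : Fin 3 // (id : Fin 3 → Fin 3) i = a} F) a))) m : ℂˣ) : ℂ)) → finrank ℂ ↥(⨅ m, Module.End.maxGenEigenspace (Representation.normalizedJacquetGL F (id : Fin 3 → Fin 3) r.ρ m) (ζ m)) = 0) → False)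
    (Φ : (Representation.parabolicIndGL F (![false, false, true] : Fin 3 → Bool) ((Representation.trivial ℂ (Π a : Bool, GL {i : Fin 3 // (![false, false, true] : Fin 3 → Bool) i = a} F) ℂ).twist ((η.comp (Matrix.GeneralLinearGroup.det.comp (Pi.evalMonoidHom (fun a : Bool => GL {i : Fin 3 // (![false, false, true] : Fin 3 → Bool) i = a} F) false))) * ((η * ((unramifiedTwist F (1 / 2) : QuasiChar F).toMonoidHom)).comp (Matrix.GeneralLinearGroup.det.comp (Pi.evalMonoidHom (fun a : Bool => GL {i : Fin 3 // (![false, false, true] : Fin 3 → Bool) i = a} F) true)))))).IntertwiningMap (Representation.parabolicIndGL F (id : Fin 3 → Fin 3) ((Representation.trivial ℂ (Π a : Fin 3, GL {i : Fin 3 // (id : Fin 3 → Fin 3) i = a} F) ℂ).twist (∏ a : Fin 3, ((![(η * ((unramifiedTwist F (1 / 2) : QuasiChar F).toMonoidHom)⁻¹), (η * ((unramifiedTwist F (1 / 2) : QuasiChar F).toMonoidHom)), (η * ((unramifiedTwist F (1 / 2) : QuasiChar F).toMonoidHom))] : Fin 3 → (Fˣ →* ℂˣ)) a).comp (Matrix.GeneralLinearGroup.det.comp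 (Pi.evalMonoidHom (fun a : Fin 3 => GL {i : Fin 3 // (id : Fin 3 → Fin 3) i = a} F) a)))))) (hΦ : Function.Injective Φ) :
    (Φ.range.quotientRep).IsIrreducible := by
  have hS := isSmooth_quotient η Φ
  haveI hfd := finiteDimensional_jacquet_quotient η hη Φ
  have hJ := nontrivial_coinvariants_of_isConstituentOf_quotient η h3cell Φ
  have hvZ := finrank_weightSpace_quotient_Z η hη Φ hΦ
  haveI hnt := nontrivial_of_finrank_weightSpace_ne_zero Φ.range.quotientRep (fun m : (Π a : Fin 3, GL {i : Fin 3 // (id : Fin 3 → Fin 3) i = a} F) => (((∏ a : Fin 3, ((![(η * ((unramifiedTwist F (1 / 2) : QuasiChar F).toMonoidHom)), (η * ((unramifiedTwist F (1 / 2) : QuasiChar F).toMonoidHom)), (η * ((unramifiedTwist F (1 / 2) : QuasiChar F).toMonoidHom)⁻¹)] : Fin 3 → (Fˣ →* ℂˣ)) a).comp (Matrix.GeneralLinearGroup.det.comp (Pi.evalMonoidHom (fun a : Fin 3 => GL {i : Fin 3 // (id : Fin 3 → Fin 3) i = a} F) a))) m : ℂˣ) : ℂ))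
    (by show finrank ℂ ↥(⨅ m, Module.End.maxGenEigenspace (Representation.normalizedJacquetGL F (id : Fin 3 → Fin 3) Φ.range.quotientRep m) (((∏ a : Fin 3, ((![(η * ((unramifiedTwist F (1 / 2) : QuasiChar F).toMonoidHom)), (η * ((unramifiedTwist F (1 / 2) : QuasiChar F).toMonoidHom)), (η * ((unramifiedTwist F (1 / 2) : QuasiChar F).toMonoidHom)⁻¹)] : Fin 3 → (Fˣ →* ℂˣ)) a).comp (Matrix.GeneralLinearGroup.det.comp (Pi.evalMonoidHom (fun a : Fin 3 => GL {i : Fin 3 // (id : Fin 3 → Fin 3) i = a} F) a))) m : ℂˣ) : ℂ)) ≠ 0; exact ne_of_eq_of_ne hvZ two_ne_zero)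
  refine { exists_pair_ne := ⟨⊥, ⊤, bot_ne_top_subrepresentation _⟩, eq_bot_or_eq_top := fun N => ?_ }
  by_contra hN
  push Not at hN
  have hpiece := exists_piece_Y_one η hη h3cell Φ hΦ N hN.1 hN.2
  rcases hpiece with ⟨hfdN, h1, h0⟩ | ⟨hfdQ, h1, h0⟩
  · haveI := hfdN
    haveI : Nontrivial ↥N.toSubmodule := Submodule.nontrivial_iff_ne_bot.2 fun h => hN.1 (Subrepresentation.toSubmodule_injective h)
    have hex :=
      exists_constituent_Y_one η N.toRepresentation (hS.toRepresentation N) (fun r hr => hJ r (hr.of_subrepresentation N)) h1 h0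
    obtain ⟨r, hr, hfdr, hr1, hr0⟩ := hex
    haveI := hfdr
    exact hNYA r (isAdmissible_of_isConstituentOf_quotient η hη Φ r (hr.of_subrepresentation N)) hr1 hr0
  · haveI := hfdQ
    have hNt : N.toSubmodule ≠ ⊤ := fun h' => hN.2 (Subrepresentation.toSubmodule_injective h')
    haveI := Submodule.Quotient.nontrivial_iff.2 hNt
    have hex :=
      exists_constituent_Y_one η N.quotientRep (hS.quotientRep N) (fun r hr => hJ r (hr.of_quotientRep N)) h1 h0
    obtain ⟨r, hr, hfdr, hr1, hr0⟩ := hex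
    haveI := hfdr
    exact hNYA r (isAdmissible_of_isConstituentOf_quotient η hη Φ r (hr.of_quotientRep N)) hr1 hr0

end Summit.HodgeConjecture.HodgeConjecture.Cruxes.H413.K2E3GL3OneLinkNestedHighQuotient

end
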